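import Mathlib

/-!
# A2RationalIso — «an isomorphism after `⊗ℝ` between rational spaces is an isomorphism» (A9) and the
restriction clause of (A4.2.7)

route/T4-A2-p6.md (cell pub-hodge-repro2, Tier 4, sub-claim A2):
* (A9): «`L^8 = θ^8 ∪ : H^4(B, ℚ) → H^{20}(B, ℚ)` is an isomorphism (rational coefficients: an
  isomorphism after `⊗ℝ` between rational spaces of the same dimension is an isomorphism)» —
  `bijective_of_baseChange`: for a field extension `K / F`, an `F`-linear map `f` whose base change
  `f ⊗ K` is bijective is bijective (injectivity because `v ↦ 1 ⊗ v` is injective; surjectivity because a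
  non-zero functional `ψ` killing the image of `f` would give a non-zero `K`-functional `Ψ(k ⊗ w) = k·ψ(w)`
  killing the image of `f ⊗ K`). No dimension count is needed.
* (A4.2.7): «Its restriction to `D_i` is a `ℚ`-linear functional `D_i → ℂ` which is non-zero (`D_i` spans
  `D_i ⊗ ℂ` over `ℂ` and `λ_{i,ν} ≠ 0`)» — `eq_zero_of_forall_one_tmul`: a `K`-linear functional on
  `K ⊗ V` vanishing on every `1 ⊗ v` is zero.
-/

namespace Summit.Ventures.HodgeRepro2.A2RationalIso

open TensorProduct

variable {F K : Type*} [Field F] [Field K] [Algebra F K]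
  {V W : Type*} [AddCommGroup V] [Module F V] [AddCommGroup W] [Module F W]

/-- (A4.2.7): a `K`-linear functional on `K ⊗ V` vanishing on the image `1 ⊗ V` of `V` is zero — the
restriction to `V` of a non-zero functional is non-zero. -/
theorem eq_zero_of_forall_one_tmul (φ : K ⊗[F] V →ₗ[K] K) (h : ∀ v : V, φ ((1 : K) ⊗ₜ[F] v) = 0) :
    φ = 0 := by
  apply LinearMap.ext
  intro x
  rw [LinearMap.zero_apply]
  induction x using TensorProduct.induction_on with
  | zero => simp
  | tmul k v =>
    have hk : k ⊗ₜ[F] v = k • ((1 : K) ⊗ₜ[F] v) := by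
      rw [TensorProduct.smul_tmul', smul_eq_mul, mul_one]
    rw [hk, map_smul, h v, smul_zero]
  | add x y hx hy => rw [map_add, hx, hy, add_zero]

/-- Injectivity descends along base change: `f ⊗ K` injective ⇒ `f` injective. -/
theorem injective_of_baseChange (f : V →ₗ[F] W) (h : Function.Injective (f.baseChange K)) :
    Function.Injective f := by
  intro v w hvw
  have h1 : f.baseChange K ((1 : K) ⊗ₜ[F] v) = f.baseChange K ((1 : K) ⊗ₜ[F] w) := by
    rw [LinearMap.baseChange_tmul, LinearMap.baseChange_tmul, hvw]
  exact Module.Flat.tensorProduct_mk_injective F V K (h h1)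

/-- The `K`-linear functional `Ψ_ψ : K ⊗ W → K`, `k ⊗ w ↦ k · ψ(w)`, attached to an `F`-linear
functional `ψ : W → F` (the base change of `ψ`, written down directly). -/
noncomputable def extendFunctional (ψ : W →ₗ[F] F) : K ⊗[F] W →ₗ[K] K :=
  TensorProduct.AlgebraTensorModule.lift
    ((LinearMap.lsmul K (W →ₗ[F] K)).flip ((Algebra.linearMap F K).comp ψ))

/-- `Ψ_ψ(k ⊗ w) = k · ψ(w)`. -/
theorem extendFunctional_tmul (ψ : W →ₗ[F] F) (k : K) (w : W) :
    extendFunctional (K := K) ψ (k ⊗ₜ[F] w) = k * algebraMap F K (ψ w) := by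
  simp [extendFunctional]

/-- Surjectivity descends along base change: `f ⊗ K` surjective ⇒ `f` surjective. (If `im f ≠ W`, a
non-zero functional `ψ` kills `im f`; then `Ψ_ψ ≠ 0` kills `im (f ⊗ K) = K ⊗ W`, a contradiction.) -/
theorem surjective_of_baseChange (f : V →ₗ[F] W) (h : Function.Surjective (f.baseChange K)) :
    Function.Surjective f := by
  rw [← LinearMap.range_eq_top]
  by_contra hne
  obtain ⟨ψ, hψ, hker⟩ := Submodule.exists_le_ker_of_lt_top _ (lt_top_iff_ne_top.2 hne)
  -- `Ψ_ψ` vanishes on the image of `f ⊗ K`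
  have hvan : ∀ y : K ⊗[F] V, extendFunctional (K := K) ψ (f.baseChange K y) = 0 := by
    intro y
    induction y using TensorProduct.induction_on with
    | zero => simp
    | tmul k v =>
      rw [LinearMap.baseChange_tmul, extendFunctional_tmul]
      have hv : ψ (f v) = 0 := hker (LinearMap.mem_range_self f v)
      rw [hv, map_zero, mul_zero]
    | add x y hx hy => rw [map_add, map_add, hx, hy, add_zero]
  -- hence `Ψ_ψ = 0`, so `ψ = 0`
  have hΨ : extendFunctional (K := K) ψ = 0 := by
    apply LinearMap.ext
    intro x
    obtain ⟨y, rfl⟩ := h x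
    rw [hvan, LinearMap.zero_apply]
  apply hψ
  apply LinearMap.ext
  intro w
  have h1 := congrArg (fun φ : K ⊗[F] W →ₗ[K] K => φ ((1 : K) ⊗ₜ[F] w)) hΨ
  simp only [extendFunctional_tmul, one_mul, LinearMap.zero_apply] at h1
  rw [LinearMap.zero_apply]
  exact (algebraMap F K).injective (by rw [map_zero]; exact h1)

/-- (A9): «an isomorphism after `⊗ℝ` between rational spaces … is an isomorphism» — if `f ⊗ K` is
bijective then `f` is bijective (`F = ℚ`, `K = ℝ`, `f = L^8 = θ^8 ∪` in the application). -/
theorem bijective_of_baseChange (f : V →ₗ[F] W) (h : Function.Bijective (f.baseChange K)) :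
    Function.Bijective f :=
  ⟨injective_of_baseChange f h.1, surjective_of_baseChange f h.2⟩

end Summit.Ventures.HodgeRepro2.A2RationalIso
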